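import Summits.ResolutionOfSingularities.ResolutionOfSingularities.Theorems.HilbertSamuelEliminationSigmaMaxModificationsCorridor3HypersurfacePoints
import Literature.AlgebraicGeometry.Resolution.HilbertSamuelLowerBound
import Literature.AlgebraicGeometry.Resolution.BoundaryHistoryMaxLocus
import Literature.AlgebraicGeometry.Resolution.AlterationsSectionDivisor
import Literature.AlgebraicGeometry.Resolution.RegularLocalRingsQuotient
import Literature.AlgebraicGeometry.Resolution.Principalization
import Literature.AlgebraicGeometry.Resolution.MarkedIdeals
import Mathlib.RingTheory.KrullDimension.Regular
import HarnessLib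

/-!
# `PatchingRelPerfect` (stmt-ResolutionOfSingularities-16161), chain W5.2 — F-32♯a discharge path (K-conn):
# THE HILBERT–SAMUEL FUNCTION OF A HYPERSURFACE `X = V(H)` (brick N5)

[OURS · L1 W5.2 · res-L1-w52-plan-1 RULING R4 (3) / NAMING N5] Fact-free, F-72-text-independent brick for the
«restart at the first regular component» discharge of the OURS binder F-32♯a. On a hypersurface `X = V(H)` of a
scheme `Z` with regular local rings along `X` (`H` locally principal of finite order along `X`) the Hilbert–Samuel
function of CJS Def. 2.28 at `x` is a function of ONE number, the order `m_x = ord_x(H)`: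
`H_X^N(x) = (n ↦ Φ^{(N+1)}(n) − Φ^{(N+1)}(n − m_x))` (second term `0` for `n < m_x`; `N + 1 ≥ dim 𝒪_{Z,x}`) — the
tree's `hypersurfaceHFe (N + 1) m_x`, INDEPENDENT of `dim 𝒪_{Z,x}`. Ring-level inputs are chain w42's
(`SigmaMaxModificationsCorridor3.Helpers`, cited by name): H1′ `stub_H1_hilbertFun_quotient_span_singleton`,
`minimalPrimesCodim_quotient_span_singleton` (`ψ(R/(g)) = e − 1`), `hsFun_eq_hypersurfaceHFe_of_stalk_ringEquiv`,
`hypersurfaceHFe_le_iff` / `_injective`. This file adds the `Φ`-reading, `H^{(k)}` for every `k`, and the packaging for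
`H.subscheme` that (K-conn) consumes: `H_X^N` is STRICTLY MONOTONE in the order, `X_max` is the top-order locus, and on
a hypersurface with a singular point every point of `X_max` — and of `X^O_max` for any history `O` (lexicographic
`H^O_X`, via the tree's `hsOMaxLocus_hsFun_subset_hsMaxLocus`) — is singular, of order `≥ 2`; also ON AN OPEN (e.g.
open-and-closed) subscheme, for the per-connected-component reading of CJS Def. 6.23 (3).

## Contents (all PROVED; no definitions, no named facts)

* §1 complements on `hypersurfaceHFe`: `hypersurfaceHFe_eq_iterPSum_sub` (the `Φ`-form `Φ^{(t)}(n) − Φ^{(t)}(n − m)`,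
  `t ≥ 1`), `hypersurfaceHFe_lt_iff`; ring level: `hilbertSamuelFun_quotient_span_singleton_eq` (**(h1)**
  `H^{(k)}(R/(g)) = hypersurfaceHFe (k + e) m` for EVERY `k`), `ringKrullDim_quotient_span_singleton_eq` (`dim R/(g) = e − 1`);
* §2 the closed subscheme `X = H.subscheme`: `nonempty_stalk_subscheme_ringEquiv` (`𝒪_{X,x} ≅ 𝒪_{Z,x}/H_x`),
  `ringKrullDim_stalk_subscheme_eq` (`dim 𝒪_{X,x} = e_x − 1`; **(h2)** `ψ_X(x) = e_x − 1` is w42's `hsPsi_eq_of_stalk_ringEquiv`),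
  **`hsFun_subscheme_eq_hypersurfaceHFe`** (`H_X^N(x) = hypersurfaceHFe (N + 1) m_x`), `hsFun_subscheme_le_iff` /
  `_lt_iff` (**(h3)**: Hilbert–Samuel functions compare as orders do; `=` by antisymmetry), `mem_hsMaxLocus_subscheme_iff`
  (`X_max` = top-order locus);
* §3 (K-conn): (i) `iterPSum_Phi_lt_hsFun_of_not_isRegularLocalRing` (ANY locally Noetherian scheme: `Φ^{(N)} < H_X^N(x)`
  at a non-regular point, from `HilbertSamuelLowerBound.lean`); `two_le_idealOrder_of_not_isRegularLocalRing_stalk`;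
  (ii) `not_isRegularLocalRing_of_mem_hsMaxLocus_subscheme` / `…_opens`; with a history:
  `not_isRegularLocalRing_of_mem_hsOMaxLocus_subscheme`, `idealOrder_le_of_mem_hsOMaxLocus_subscheme` (on an open `U`: compose
  `…_opens` with `hsOMaxLocus_hsFun_subset_hsMaxLocus (X := ↑U)`).

Honest framing: OURS (AI-written, weaker than expert review); compositions of tree theorems; nothing here is a
statement of the manuscript under review, and no fact of the F-72 text is used.

## Sources

* V. Cossart, U. Jannsen, S. Saito, LNM 2270 (2020): §2.2 (p. 27), Def. 2.13, Thm. 2.3, Def. 2.28 (`ψ_X`, `H_X^N`),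
  Lemma 2.23, Lemma 2.31 / Rem. 2.32, Def. 2.35 (`X_max`), Ch. 4 p. 55 (`H^O_X`), Lemma 6.3 (b), Def. 6.23 (3),
  Rem. 6.29. [CossartJannsenSaito2020]
* H. Matsumura, *Commutative Ring Theory* (1986): Thm. 13.5, 14.2, 17.4 (ii), 17.10 [Matsumura1987]; Stacks 01WR [StacksProject]
-/

set_option linter.dupNamespace false -- mandated namespace of this single-conjunct summit

noncomputable section

open CategoryTheory AlgebraicGeometry TopologicalSpace IsLocalRing
open Literature.RingTheory.HilbertSamuel Literature.AlgebraicGeometry.Resolution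
open Summit.ResolutionOfSingularities.ResolutionOfSingularities.Theorems.SigmaMaxModificationsCorridor3.Helpers

namespace Summit.ResolutionOfSingularities.ResolutionOfSingularities.Theorems.DepthLegal

universe u

/-! ## §1 Complements: the `Φ`-form of `hypersurfaceHFe`, strict comparison, `H^{(k)}(R/(g))` for every `k` -/

/-- **The `Φ`-form**: for `t ≥ 1`, `hypersurfaceHFe t m n = Φ^{(t)}(n) − Φ^{(t)}(n − m)`, the second term read as `0`
for `n < m` (the guard matters: `ℕ`-subtraction alone is wrong at `n < m`). [cite: CossartJannsenSaito2020, Def. 2.13] -/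
theorem hypersurfaceHFe_eq_iterPSum_sub {t : ℕ} (ht : 1 ≤ t) (m n : ℕ) :
    hypersurfaceHFe t m n = iterPSum t Phi n - if m ≤ n then iterPSum t Phi (n - m) else 0 := by
  obtain ⟨s, rfl⟩ : ∃ s, t = s + 1 := ⟨t - 1, by omega⟩
  simp only [hypersurfaceHFe_apply, iterPSum_succ_Phi_eq_choose]
  rw [show n + (s + 1) - 1 = n + s by omega, show s + 1 - 1 = s by omega]
  split_ifs with h
  · rw [show n - m + (s + 1) - 1 = n - m + s by omega]
  · rfl

/-- `hypersurfaceHFe t m < hypersurfaceHFe t m' ↔ m < m'` (`t ≥ 1`, product order; from w42's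
`hypersurfaceHFe_le_iff`). [cite: CossartJannsenSaito2020, Thm. 2.3] -/
theorem hypersurfaceHFe_lt_iff {t : ℕ} (ht : 1 ≤ t) {m m' : ℕ} :
    hypersurfaceHFe t m < hypersurfaceHFe t m' ↔ m < m' := by
  rw [lt_iff_le_not_ge, hypersurfaceHFe_le_iff ht, hypersurfaceHFe_le_iff ht, lt_iff_le_not_ge]

section Ring

variable {R : Type u} [CommRing R] [IsRegularLocalRing R]

/-- A regular local ring containing a non-zero non-unit has dimension `≥ 1` (the principal ideal `(g)` has height
`≥ 1` and `≤ ht 𝔪 = dim R`). [folklore] -/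
theorem one_le_of_ringKrullDim_eq {e : ℕ} (he : ringKrullDim R = e) {g : R} (hg : g ∈ maximalIdeal R)
    (hg0 : g ≠ 0) : 1 ≤ e := by
  haveI : IsDomain R := isDomain_of_isRegularLocalRing R
  have h1 := Ideal.one_le_height_span_singleton_of_mem_nonZeroDivisors (mem_nonZeroDivisors_of_ne_zero hg0)
  have h2 : (Ideal.span {g}).height ≤ (maximalIdeal R).height :=
    Ideal.height_mono ((Ideal.span_singleton_le_iff_mem _).mpr hg)
  have h3 : ((maximalIdeal R).height : WithBot ℕ∞) = e := by
    rw [IsLocalRing.maximalIdeal_height_eq_ringKrullDim, he]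
  have h4 : (maximalIdeal R).height = e := by exact_mod_cast h3
  have h5 : (1 : ℕ∞) ≤ e := h4 ▸ h1.trans h2
  exact_mod_cast h5

/-- **(h1) `H^{(k)}(R/(g)) = Φ^{(e+k)} − Φ^{(e+k)}(· − m)` for EVERY `k`** (`R` regular local of dimension `e`, `g` of order
exactly `m`): w42's H1′ (`k = 0`) and `iterPSum_hypersurfaceHFe_succ` (iterated sums commute with the shift).
[cite: CossartJannsenSaito2020, §2.2 (p. 27), Thm. 2.3] [cite: Matsumura1987, Thm. 17.10] -/
theorem hilbertSamuelFun_quotient_span_singleton_eq {e m : ℕ} (he : ringKrullDim R = e) {g : R}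
    (hg : g ∈ maximalIdeal R ^ m) (hg' : g ∉ maximalIdeal R ^ (m + 1)) [IsLocalRing (R ⧸ Ideal.span {g})]
    (k : ℕ) : hilbertSamuelFun (R ⧸ Ideal.span {g}) k = hypersurfaceHFe (k + e) m := by
  -- `g` is a non-zero non-unit: `R/(g)` is a (non-trivial) local ring and `g ∉ 𝔪^{m+1}`
  have hg0 : g ≠ 0 := fun h => hg' (h ▸ zero_mem _)
  have hgm : g ∈ maximalIdeal R := by
    by_contra hu
    have hunit : IsUnit g := by simpa [IsLocalRing.mem_maximalIdeal] using hu
    have hsub : Subsingleton (R ⧸ Ideal.span {g}) :=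
      Ideal.Quotient.subsingleton_iff.mpr (Ideal.span_singleton_eq_top.mpr hunit)
    exact false_of_nontrivial_of_subsingleton (R ⧸ Ideal.span {g})
  obtain ⟨t, rfl⟩ : ∃ t, e = t + 1 := ⟨e - 1, by have := one_le_of_ringKrullDim_eq he hgm hg0; omega⟩
  show iterPSum k (hilbertFun _) = _
  rw [stub_H1_hilbertFun_quotient_span_singleton he hg hg', iterPSum_hypersurfaceHFe_succ,
    show t + 1 + k = k + (t + 1) by omega]

/-- The dimension of the hypersurface ring: `dim R/(g) = e − 1` (`0 ≠ g ∈ 𝔪`). [cite: Matsumura1987, Thm. 13.5] -/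
theorem ringKrullDim_quotient_span_singleton_eq {e : ℕ} (he : ringKrullDim R = e) {g : R}
    (hg : g ∈ maximalIdeal R) (hg0 : g ≠ 0) : ringKrullDim (R ⧸ Ideal.span {g}) = ((e - 1 : ℕ) : WithBot ℕ∞) := by
  haveI : IsDomain R := isDomain_of_isRegularLocalRing R
  have he1 : 1 ≤ e := one_le_of_ringKrullDim_eq he hg hg0
  have hne : Ideal.span {g} ≠ ⊤ := fun h =>
    (IsLocalRing.mem_maximalIdeal g).mp hg (Ideal.span_singleton_eq_top.mp h)
  haveI : Nontrivial (R ⧸ Ideal.span {g}) := Ideal.Quotient.nontrivial_iff.mpr hne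
  haveI := isLocalRing_quotient (R := R) (I := Ideal.span {g}) hne
  obtain ⟨d, hd⟩ := exists_nat_eq_of_ne_bot_of_ne_top (d := ringKrullDim (R ⧸ Ideal.span {g}))
    ringKrullDim_ne_bot ringKrullDim_ne_top
  have h := ringKrullDim_quotient_span_singleton_succ_eq_ringKrullDim_of_mem_nonZeroDivisors
    (mem_nonZeroDivisors_of_ne_zero hg0) hg
  rw [hd, he] at h
  have hde : d + 1 = e := by exact_mod_cast h
  rw [hd, show e - 1 = d by omega]

end Ring

/-! ## §2 The closed subscheme `X = V(H)` of a scheme with regular local rings along `X` -/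

section Subscheme

variable {Z : Scheme.{u}} (H : Z.IdealSheafData)

/-- A locally principal ideal sheaf has principal stalks. [cite: StacksProject, Tag 01WR] -/
theorem exists_eq_span_stalkIdeal {z : Z} (h : IsLocallyPrincipalAt H z) :
    ∃ g : Z.presheaf.stalk z, stalkIdeal H z = Ideal.span {g} := by
  obtain ⟨U, hzU, f, hf⟩ := h
  exact ⟨(Z.presheaf.germ U z hzU).hom f, by
    rw [stalkIdeal_eq_map_germ H U hzU, hf, Ideal.map_span, Set.image_singleton]⟩

/-- A generator of a stalk of order exactly `m` lies in `𝔪^m ∖ 𝔪^{m+1}`. [cite: BierstoneGrigorievMilmanWlodarczyk2011, §3.1 p. 6] -/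
theorem mem_pow_of_idealOrder_eq {z : Z} {g : Z.presheaf.stalk z} (hg : stalkIdeal H z = Ideal.span {g}) {m : ℕ}
    (hm : idealOrder H z = m) :
    g ∈ maximalIdeal (Z.presheaf.stalk z) ^ m ∧ g ∉ maximalIdeal (Z.presheaf.stalk z) ^ (m + 1) := by
  have h1 : stalkIdeal H z ≤ maximalIdeal _ ^ m := (le_idealOrder_iff H z m).mp hm.ge
  have h2 : ¬ stalkIdeal H z ≤ maximalIdeal _ ^ (m + 1) := fun hle => by
    have h := (le_idealOrder_iff H z (m + 1)).mpr hle
    rw [hm] at h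
    have h' : m + 1 ≤ m := by exact_mod_cast h
    omega
  rw [hg, Ideal.span_singleton_le_iff_mem] at h1 h2
  exact ⟨h1, h2⟩

/-- A point of `V(H)` maps into the support of `H`. [folklore] -/
theorem subschemeι_mem_support (x : H.subscheme) : H.subschemeι.base x ∈ H.support := by
  have h : H.subschemeι.base x ∈ Set.range H.subschemeι.base := ⟨x, rfl⟩
  rwa [Scheme.IdealSheafData.range_subschemeι] at h

/-- **The local rings of `V(H)` are the `𝒪_{Z,x}/H_x`** (the stalk map of `V(H) → Z` is onto with kernel `H_x`). [folklore] -/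
theorem nonempty_stalk_subscheme_ringEquiv (x : H.subscheme) :
    Nonempty ((Z.presheaf.stalk (H.subschemeι.base x) ⧸ stalkIdeal H (H.subschemeι.base x)) ≃+*
      H.subscheme.presheaf.stalk x) := by
  have hsurj : Function.Surjective (H.subschemeι.stalkMap x).hom := H.subschemeι.stalkMap_surjective x
  have hker : RingHom.ker (H.subschemeι.stalkMap x).hom = stalkIdeal H (H.subschemeι.base x) := by
    rw [← stalkIdeal_ker_eq_ker_stalkMap H.subschemeι x, Scheme.IdealSheafData.ker_subschemeι]
  exact ⟨(Ideal.quotEquivOfEq hker.symm).trans (RingHom.quotientKerEquivOfSurjective hsurj)⟩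

/-- At a point `x` of `V(H)` (`H` locally principal at `x`, of order `m`): a generator `g` of `H_x` with
`g ∈ 𝔪^m ∖ 𝔪^{m+1}`, `g ∈ 𝔪`, `g ≠ 0`. [cite: StacksProject, Tag 01WR] -/
theorem exists_generator_stalkIdeal (x : H.subscheme) (hH : IsLocallyPrincipalAt H (H.subschemeι.base x)) {m : ℕ}
    (hm : idealOrder H (H.subschemeι.base x) = m) :
    ∃ g : Z.presheaf.stalk (H.subschemeι.base x), stalkIdeal H (H.subschemeι.base x) = Ideal.span {g} ∧
      g ∈ maximalIdeal _ ^ m ∧ g ∉ maximalIdeal _ ^ (m + 1) ∧ g ∈ maximalIdeal _ ∧ g ≠ 0 := by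
  obtain ⟨g, hg⟩ := exists_eq_span_stalkIdeal H hH
  obtain ⟨hgm, hgm'⟩ := mem_pow_of_idealOrder_eq H hg hm
  have hgmax : g ∈ maximalIdeal _ := by
    have h := (mem_support_iff_stalkIdeal_le H _).mp (subschemeι_mem_support H x)
    rw [hg, Ideal.span_singleton_le_iff_mem] at h
    exact h
  exact ⟨g, hg, hgm, hgm', hgmax, fun h => hgm' (h ▸ zero_mem _)⟩

/-- **The local ring of the hypersurface at `x` has dimension `e_x − 1`.** [cite: Matsumura1987, Thm. 13.5] -/
theorem ringKrullDim_stalk_subscheme_eq (x : H.subscheme) [IsRegularLocalRing (Z.presheaf.stalk (H.subschemeι.base x))]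
    (hH : IsLocallyPrincipalAt H (H.subschemeι.base x)) {m : ℕ} (hm : idealOrder H (H.subschemeι.base x) = m)
    {e : ℕ} (he : ringKrullDim (Z.presheaf.stalk (H.subschemeι.base x)) = e) :
    ringKrullDim (H.subscheme.presheaf.stalk x) = ((e - 1 : ℕ) : WithBot ℕ∞) := by
  obtain ⟨g, hg, -, -, hgmax, hg0⟩ := exists_generator_stalkIdeal H x hH hm
  obtain ⟨ε⟩ := nonempty_stalk_subscheme_ringEquiv H x
  rw [← ringKrullDim_eq_of_ringEquiv ((Ideal.quotEquivOfEq hg.symm).trans ε),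
    ringKrullDim_quotient_span_singleton_eq he hgmax hg0]

/-- **(h2) THE HILBERT–SAMUEL FUNCTION OF A HYPERSURFACE: `H_X^N(x) = Φ^{(N+1)} − Φ^{(N+1)}(· − m_x)`**
(`= hypersurfaceHFe (N + 1) m_x`), for `X = V(H) ⊆ Z`, `𝒪_{Z,x}` regular of dimension `e_x ≤ N + 1`, `H` locally
principal at `x` of order `m_x` — a function of the order ALONE, independent of `e_x`.
[cite: CossartJannsenSaito2020, Def. 2.28, §2.2 (p. 27), Thm. 2.3] [cite: Matsumura1987, Thm. 17.10, Thm. 17.4 (ii)] -/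
theorem hsFun_subscheme_eq_hypersurfaceHFe (x : H.subscheme)
    [IsRegularLocalRing (Z.presheaf.stalk (H.subschemeι.base x))]
    (hH : IsLocallyPrincipalAt H (H.subschemeι.base x)) {m : ℕ} (hm : idealOrder H (H.subschemeι.base x) = m)
    {e : ℕ} (he : ringKrullDim (Z.presheaf.stalk (H.subschemeι.base x)) = e) {N : ℕ} (hN : e ≤ N + 1) :
    Scheme.hsFun H.subscheme N x = hypersurfaceHFe (N + 1) m := by
  obtain ⟨g, hg, hgm, hgm', -, -⟩ := exists_generator_stalkIdeal H x hH hm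
  have hm1 : 1 ≤ m := by
    have h := (one_le_idealOrder_iff H _).mpr (subschemeι_mem_support H x)
    rw [hm] at h
    exact_mod_cast h
  obtain ⟨ε⟩ := nonempty_stalk_subscheme_ringEquiv H x
  exact hsFun_eq_hypersurfaceHFe_of_stalk_ringEquiv he hN hm1 hgm hgm' ((Ideal.quotEquivOfEq hg.symm).trans ε).symm

/-- **(h3) `H_X^N(x) ≤ H_X^N(y) ↔ ord_x(H) ≤ ord_y(H)`** on a hypersurface. [cite: CossartJannsenSaito2020, Def. 2.28, Thm. 2.3] -/
theorem hsFun_subscheme_le_iff {x y : H.subscheme}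
    [IsRegularLocalRing (Z.presheaf.stalk (H.subschemeι.base x))]
    [IsRegularLocalRing (Z.presheaf.stalk (H.subschemeι.base y))]
    (hx : IsLocallyPrincipalAt H (H.subschemeι.base x)) (hy : IsLocallyPrincipalAt H (H.subschemeι.base y))
    {mx my : ℕ} (hmx : idealOrder H (H.subschemeι.base x) = mx) (hmy : idealOrder H (H.subschemeι.base y) = my)
    {ex ey N : ℕ} (hex : ringKrullDim (Z.presheaf.stalk (H.subschemeι.base x)) = ex)
    (hey : ringKrullDim (Z.presheaf.stalk (H.subschemeι.base y)) = ey) (hNx : ex ≤ N + 1) (hNy : ey ≤ N + 1) :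
    Scheme.hsFun H.subscheme N x ≤ Scheme.hsFun H.subscheme N y ↔ mx ≤ my := by
  rw [hsFun_subscheme_eq_hypersurfaceHFe H x hx hmx hex hNx, hsFun_subscheme_eq_hypersurfaceHFe H y hy hmy hey hNy,
    hypersurfaceHFe_le_iff (by omega)]

/-- `H_X^N(x) < H_X^N(y) ↔ ord_x(H) < ord_y(H)` on a hypersurface. [cite: CossartJannsenSaito2020, Def. 2.28, Thm. 2.3] -/
theorem hsFun_subscheme_lt_iff {x y : H.subscheme}
    [IsRegularLocalRing (Z.presheaf.stalk (H.subschemeι.base x))]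
    [IsRegularLocalRing (Z.presheaf.stalk (H.subschemeι.base y))]
    (hx : IsLocallyPrincipalAt H (H.subschemeι.base x)) (hy : IsLocallyPrincipalAt H (H.subschemeι.base y))
    {mx my : ℕ} (hmx : idealOrder H (H.subschemeι.base x) = mx) (hmy : idealOrder H (H.subschemeι.base y) = my)
    {ex ey N : ℕ} (hex : ringKrullDim (Z.presheaf.stalk (H.subschemeι.base x)) = ex)
    (hey : ringKrullDim (Z.presheaf.stalk (H.subschemeι.base y)) = ey) (hNx : ex ≤ N + 1) (hNy : ey ≤ N + 1) :
    Scheme.hsFun H.subscheme N x < Scheme.hsFun H.subscheme N y ↔ mx < my := by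
  rw [hsFun_subscheme_eq_hypersurfaceHFe H x hx hmx hex hNx, hsFun_subscheme_eq_hypersurfaceHFe H y hy hmy hey hNy,
    hypersurfaceHFe_lt_iff (by omega)]

/-- **The Hilbert–Samuel locus of a hypersurface is the locus of maximal order**: for `X = V(H)` with regular ambient
local rings of dimension `≤ N + 1` along `X` and `H` locally principal of finite order along `X`,
`x ∈ X_max ↔ ord_y(H) ≤ ord_x(H)` for all `y ∈ X`. [cite: CossartJannsenSaito2020, Def. 2.35, Thm. 2.3] -/
theorem mem_hsMaxLocus_subscheme_iff {N : ℕ}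
    (hreg : ∀ x : H.subscheme, IsRegularLocalRing (Z.presheaf.stalk (H.subschemeι.base x)))
    (hH : ∀ x : H.subscheme, IsLocallyPrincipalAt H (H.subschemeι.base x))
    (hfin : ∀ x : H.subscheme, idealOrder H (H.subschemeι.base x) ≠ ⊤)
    (hdim : ∀ x : H.subscheme, ∃ e : ℕ, ringKrullDim (Z.presheaf.stalk (H.subschemeι.base x)) = e ∧ e ≤ N + 1)
    (x : H.subscheme) :
    x ∈ Scheme.hsMaxLocus H.subscheme N ↔
      ∀ y : H.subscheme, idealOrder H (H.subschemeι.base y) ≤ idealOrder H (H.subschemeι.base x) := by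
  -- name the orders
  have hm : ∀ y : H.subscheme, ∃ m : ℕ, idealOrder H (H.subschemeι.base y) = m := fun y =>
    (ENat.ne_top_iff_exists.mp (hfin y)).imp fun _ h => h.symm
  choose m hm using hm
  have hval : ∀ y : H.subscheme, Scheme.hsFun H.subscheme N y = hypersurfaceHFe (N + 1) (m y) := fun y => by
    haveI := hreg y
    obtain ⟨e, he, heN⟩ := hdim y
    exact hsFun_subscheme_eq_hypersurfaceHFe H y (hH y) (hm y) he heN
  have hord : ∀ y : H.subscheme, idealOrder H (H.subschemeι.base y) ≤ idealOrder H (H.subschemeι.base x) ↔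
      m y ≤ m x := fun y => by rw [hm y, hm x, Nat.cast_le]
  simp only [hord, Scheme.mem_hsMaxLocus_iff]
  constructor
  · intro hmax y
    by_contra hlt
    rw [not_le] at hlt
    have hlt' : Scheme.hsFun H.subscheme N x < Scheme.hsFun H.subscheme N y := by
      rw [hval, hval]
      exact (hypersurfaceHFe_lt_iff (by omega)).mpr hlt
    exact hlt'.not_ge (hmax.2 ⟨y, rfl⟩ hlt'.le)
  · intro h
    refine ⟨⟨x, rfl⟩, ?_⟩
    rintro _ ⟨y, rfl⟩ -
    rw [hval, hval]
    exact hypersurfaceHFe_mono_right _ (h y)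

/-! ## §3 (K-conn): the Hilbert–Samuel locus of a singular hypersurface lies in the singular locus -/

/-- **(K-conn) (i), for ANY locally Noetherian scheme**: at a non-regular point `Φ^{(N)} < H_X^N(x)` (`≤` and `≠`;
CJS Lemma 2.23 / Lemma 2.31 from `HilbertSamuelLowerBound.lean`). [cite: CossartJannsenSaito2020, Lemma 2.23, Lemma 2.31] -/
theorem iterPSum_Phi_lt_hsFun_of_not_isRegularLocalRing {X : Scheme.{u}} [IsLocallyNoetherian X] (N : ℕ) {x : X}
    (hx : ¬ IsRegularLocalRing (X.presheaf.stalk x)) : iterPSum N Phi < Scheme.hsFun X N x :=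
  lt_of_le_of_ne (Scheme.iterPSum_Phi_le_hsFun N x) fun h =>
    hx ((Scheme.hsFun_eq_iterPSum_Phi_iff N x).mp h.symm).1

/-- **A singular point of a hypersurface has order `≥ 2`**: if `𝒪_{X,x} = 𝒪_{Z,x}/(g)` is not regular then
`g ∈ 𝔪_x²` (Matsumura 14.2). [cite: Matsumura1987, Thm. 14.2] -/
theorem two_le_idealOrder_of_not_isRegularLocalRing_stalk (x : H.subscheme)
    [IsRegularLocalRing (Z.presheaf.stalk (H.subschemeι.base x))] (hH : IsLocallyPrincipalAt H (H.subschemeι.base x))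
    (hx : ¬ IsRegularLocalRing (H.subscheme.presheaf.stalk x)) : 2 ≤ idealOrder H (H.subschemeι.base x) := by
  obtain ⟨g, hg⟩ := exists_eq_span_stalkIdeal H hH
  have hgmax : g ∈ maximalIdeal _ := by
    have h := (mem_support_iff_stalkIdeal_le H _).mp (subschemeι_mem_support H x)
    rw [hg, Ideal.span_singleton_le_iff_mem] at h
    exact h
  have hg2 : g ∈ maximalIdeal _ ^ 2 := by
    by_contra h2
    obtain ⟨ε⟩ := nonempty_stalk_subscheme_ringEquiv H x
    haveI := (IsRegularLocalRing.quotient_span_singleton hgmax h2).1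
    exact hx (IsRegularLocalRing.of_ringEquiv ((Ideal.quotEquivOfEq hg.symm).trans ε))
  rw [show (2 : ℕ∞) = ((2 : ℕ) : ℕ∞) from rfl, le_idealOrder_iff, hg, Ideal.span_singleton_le_iff_mem]
  exact hg2

/-- **(K-conn) (ii): on a hypersurface with a singular point, every point of the Hilbert–Samuel locus is singular, of
order `≥ 2`** (`X = V(H) ⊆ Z`, regular ambient local rings of dimension `≤ N + 1` along `X`, `H` locally principal of
finite order along `X`). [cite: CossartJannsenSaito2020, Def. 2.35, Rem. 2.32, Rem. 6.29] -/
theorem not_isRegularLocalRing_of_mem_hsMaxLocus_subscheme [IsLocallyNoetherian Z] {N : ℕ}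
    (hreg : ∀ x : H.subscheme, IsRegularLocalRing (Z.presheaf.stalk (H.subschemeι.base x)))
    (hH : ∀ x : H.subscheme, IsLocallyPrincipalAt H (H.subschemeι.base x))
    (hfin : ∀ x : H.subscheme, idealOrder H (H.subschemeι.base x) ≠ ⊤)
    (hdim : ∀ x : H.subscheme, ∃ e : ℕ, ringKrullDim (Z.presheaf.stalk (H.subschemeι.base x)) = e ∧ e ≤ N + 1)
    (hsing : ∃ y : H.subscheme, ¬ IsRegularLocalRing (H.subscheme.presheaf.stalk y))
    {x : H.subscheme} (hx : x ∈ Scheme.hsMaxLocus H.subscheme N) :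
    ¬ IsRegularLocalRing (H.subscheme.presheaf.stalk x) ∧ 2 ≤ idealOrder H (H.subschemeι.base x) := by
  haveI : IsLocallyNoetherian H.subscheme := LocallyOfFiniteType.isLocallyNoetherian H.subschemeι
  have hdimX : ∀ y : H.subscheme, ∃ d : ℕ, ringKrullDim (H.subscheme.presheaf.stalk y) = d ∧ d ≤ N := fun y => by
    haveI := hreg y
    obtain ⟨e, he, heN⟩ := hdim y
    obtain ⟨m, hm⟩ := ENat.ne_top_iff_exists.mp (hfin y)
    exact ⟨e - 1, ringKrullDim_stalk_subscheme_eq H y (hH y) hm.symm he, by omega⟩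
  have hX : ¬ Scheme.IsRegular H.subscheme := fun h => hsing.elim fun y hy => hy (h y)
  have h1 : ¬ IsRegularLocalRing (H.subscheme.presheaf.stalk x) :=
    Scheme.hsMaxLocus_subset_compl_regularLocus hdimX hX hx
  haveI := hreg x
  exact ⟨h1, two_le_idealOrder_of_not_isRegularLocalRing_stalk H x (hH x) h1⟩

/-- **(K-conn) (ii) on an OPEN subscheme** `U ⊆ X = V(H)` (e.g. an open-and-closed one: the per-connected-component
reading of CJS Def. 6.23 (3)), the Hilbert–Samuel locus computed ON `U`: if `U` has a singular point then every
point of `U_max` is a singular point of `X`, of order `≥ 2`. [cite: CossartJannsenSaito2020, Def. 6.23 (3), Def. 2.35] -/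
theorem not_isRegularLocalRing_of_mem_hsMaxLocus_opens [IsLocallyNoetherian Z] {N : ℕ}
    (hreg : ∀ x : H.subscheme, IsRegularLocalRing (Z.presheaf.stalk (H.subschemeι.base x)))
    (hH : ∀ x : H.subscheme, IsLocallyPrincipalAt H (H.subschemeι.base x))
    (hfin : ∀ x : H.subscheme, idealOrder H (H.subschemeι.base x) ≠ ⊤)
    (hdim : ∀ x : H.subscheme, ∃ e : ℕ, ringKrullDim (Z.presheaf.stalk (H.subschemeι.base x)) = e ∧ e ≤ N + 1)
    (U : H.subscheme.Opens) (hsing : ∃ v : U, ¬ IsRegularLocalRing ((U : Scheme.{u}).presheaf.stalk v))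
    {u : U} (hu : u ∈ Scheme.hsMaxLocus (U : Scheme.{u}) N) :
    ¬ IsRegularLocalRing (H.subscheme.presheaf.stalk (U.ι.base u)) ∧
      2 ≤ idealOrder H (H.subschemeι.base (U.ι.base u)) := by
  haveI : IsLocallyNoetherian H.subscheme := LocallyOfFiniteType.isLocallyNoetherian H.subschemeι
  -- the local rings of `U` are those of `X`
  have ε : ∀ v : U, H.subscheme.presheaf.stalk (U.ι.base v) ≃+* (U : Scheme.{u}).presheaf.stalk v := fun v =>
    (asIso (U.ι.stalkMap v)).commRingCatIsoToRingEquiv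
  have hdimU : ∀ v : U, ∃ d : ℕ, ringKrullDim ((U : Scheme.{u}).presheaf.stalk v) = d ∧ d ≤ N := fun v => by
    haveI := hreg (U.ι.base v)
    obtain ⟨e, he, heN⟩ := hdim (U.ι.base v)
    obtain ⟨m, hm⟩ := ENat.ne_top_iff_exists.mp (hfin (U.ι.base v))
    refine ⟨e - 1, ?_, by omega⟩
    rw [← ringKrullDim_eq_of_ringEquiv (ε v)]
    exact ringKrullDim_stalk_subscheme_eq H (U.ι.base v) (hH _) hm.symm he
  have hU : ¬ Scheme.IsRegular (U : Scheme.{u}) := fun h => hsing.elim fun v hv => hv (h v)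
  have h1 : ¬ IsRegularLocalRing ((U : Scheme.{u}).presheaf.stalk u) :=
    Scheme.hsMaxLocus_subset_compl_regularLocus hdimU hU hu
  have h2 : ¬ IsRegularLocalRing (H.subscheme.presheaf.stalk (U.ι.base u)) := fun h =>
    h1 (IsRegularLocalRing.of_ringEquiv (ε u))
  haveI := hreg (U.ι.base u)
  exact ⟨h2, two_le_idealOrder_of_not_isRegularLocalRing_stalk H (U.ι.base u) (hH _) h2⟩

/-! ## §3 (K-conn) with a history `O` (lexicographic `H^O_X`): `X^O_max ⊆ X_max ⊆ {2 ≤ ord}` -/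

/-- **(K-conn) (ii) with history**: for any history function `O` on the points of the hypersurface `X = V(H)`, if `X`
has a singular point then every point of the `O`-Hilbert–Samuel locus `X^O_max` (for `H^O_X = (H_X^N, |O|)` with
the lexicographic order) is singular, of order `≥ 2` — by `X^O_max ⊆ X_max`
(`hsOMaxLocus_hsFun_subset_hsMaxLocus`). [cite: CossartJannsenSaito2020, Lemma 6.3 (b), Def. 6.23 (3)] -/
theorem not_isRegularLocalRing_of_mem_hsOMaxLocus_subscheme [IsLocallyNoetherian Z] {N : ℕ} {ι : Type*}
    (hreg : ∀ x : H.subscheme, IsRegularLocalRing (Z.presheaf.stalk (H.subschemeι.base x)))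
    (hH : ∀ x : H.subscheme, IsLocallyPrincipalAt H (H.subschemeι.base x))
    (hfin : ∀ x : H.subscheme, idealOrder H (H.subschemeι.base x) ≠ ⊤)
    (hdim : ∀ x : H.subscheme, ∃ e : ℕ, ringKrullDim (Z.presheaf.stalk (H.subschemeι.base x)) = e ∧ e ≤ N + 1)
    (hsing : ∃ y : H.subscheme, ¬ IsRegularLocalRing (H.subscheme.presheaf.stalk y))
    (O : H.subscheme → Set ι) {x : H.subscheme}
    (hx : x ∈ BoundaryHistory.hsOMaxLocus (Scheme.hsFun H.subscheme N) O) :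
    ¬ IsRegularLocalRing (H.subscheme.presheaf.stalk x) ∧ 2 ≤ idealOrder H (H.subschemeι.base x) :=
  not_isRegularLocalRing_of_mem_hsMaxLocus_subscheme H hreg hH hfin hdim hsing
    (hsOMaxLocus_hsFun_subset_hsMaxLocus N O hx)

/-- **`X^O_max` of a hypersurface lies in the top-order locus** (any history `O`).
[cite: CossartJannsenSaito2020, Lemma 6.3 (b), Def. 2.35] -/
theorem idealOrder_le_of_mem_hsOMaxLocus_subscheme {N : ℕ} {ι : Type*}
    (hreg : ∀ x : H.subscheme, IsRegularLocalRing (Z.presheaf.stalk (H.subschemeι.base x)))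
    (hH : ∀ x : H.subscheme, IsLocallyPrincipalAt H (H.subschemeι.base x))
    (hfin : ∀ x : H.subscheme, idealOrder H (H.subschemeι.base x) ≠ ⊤)
    (hdim : ∀ x : H.subscheme, ∃ e : ℕ, ringKrullDim (Z.presheaf.stalk (H.subschemeι.base x)) = e ∧ e ≤ N + 1)
    (O : H.subscheme → Set ι) {x : H.subscheme}
    (hx : x ∈ BoundaryHistory.hsOMaxLocus (Scheme.hsFun H.subscheme N) O) (y : H.subscheme) :
    idealOrder H (H.subschemeι.base y) ≤ idealOrder H (H.subschemeι.base x) :=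
  (mem_hsMaxLocus_subscheme_iff H hreg hH hfin hdim x).mp (hsOMaxLocus_hsFun_subset_hsMaxLocus N O hx) y

end Subscheme

end Summit.ResolutionOfSingularities.ResolutionOfSingularities.Theorems.DepthLegal

end
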